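import Summits.CriticalPhenomena.CardyFormulaZ2.Theorems.CardyFlipRussoQuadrupoleSelectionRuleFlipLocalisation
import Literature.Probability.LatticeModels.ProdBernoulliIndependence
import Literature.Probability.Percolation.SitePercolationMeasure

/-!
# Factorisation of the flip response: `Δ_Q` is `p²(1−p)²` times a four-arm probability

Helper file for the crux `QuadrupoleSelectionRule` (stmt-CriticalPhenomena-7029, informal) of route
`CardyFlipRusso` (sub-problem `CardyFormulaZ2`), line `Sketch`, stub U1: the four-arm
FACTORISATION of the flip response.

By `crossing_flipGraph_sdiff_subset` (file `…FlipLocalisation`), for a quadrilateral `ABCD` of `G`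
with `A, C` in the domain `S`, the event `D₁ := U(flip G) ∖ U(G)` ("the diagonal flip `AC ↝ BD`
creates a crossing `U = {∃ u ∈ X, ∃ v ∈ Y, u ⟷ v in S}`") lies in the cylinder
`Cyl := {B, D open, A, C closed}`. Here the cylinder is factored out: with the local modification
`Φ ω := (ω ∪ {B, D}) ∖ {A, C}` (open `B, D`, close `A, C`) one has `D₁ = Cyl ∩ Φ⁻¹(D₁)`, the event
`Φ⁻¹(D₁)` is determined by the sites outside `{A, B, C, D}` and `Cyl` by these four sites, so that
by independence of disjoint sets of sites under the product measure `P_p`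

`P_p[D₁] = P_p[Cyl] · P_p[Φ⁻¹(D₁)] = p² (1 − p)² · P_p[Φ ω ∈ D₁]`,

and `{Φ ω ∈ D₁}` is a genuine FOUR-ARM event read off the quadrilateral (two open arms from
`B, D` to `X, Y` inside `S`, separated by closed arms through `A, C`).

## Contents (namespace `Summit.CriticalPhenomena.CardyFormulaZ2.Theorems`)

* `measurable_quadModify`, `quadModify_eq_self`, `determinedBy_preimage_quadModify` — the local
  modification `Φ` is measurable, is the identity on `Cyl`, and `Φ⁻¹(E)` is determined by the
  sites outside `{A, B, C, D}`;
* `determinedBy_quadCylinder`, `quadCyl_determinedBy_subset`, `quadCyl_determinedBy_forall_notMem`,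
  `sitePercolation_real_quadCylinder` — `Cyl` is determined by `{A, B, C, D}` (and the cylinders
  "`F` open", "`F` closed" by `F`), and `P_p[Cyl] = p² (1 − p)²` for four distinct vertices;
* `sitePercolation_real_eq_of_subset_quadCylinder` — `P_p[E] = p²(1−p)² · P_p[Φ⁻¹(E)]` for every
  measurable `E ⊆ Cyl`;
* `crossing_flipGraph_real_sdiff_eq` — the stub: the factorisation for `E = U(flip G) ∖ U(G)`.

## References

* G. Grimmett, *Percolation* (1999), §2.2 (events depending on finitely many sites; product
  measure), §2.4 (pivotality, Russo's formula).
* V. Beffara, *Is critical 2D percolation universal?* (2008), §5.2 Prop. 18.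
-/

noncomputable section

open MeasureTheory

namespace Summit.CriticalPhenomena.CardyFormulaZ2.Theorems

open Literature.Probability.Percolation Literature.Probability.LatticeModels

variable {V : Type*}

/-! ### The local modification `Φ ω = (ω ∪ {B, D}) ∖ {A, C}` -/

/-- Configurations agreeing on `F` agree at every site of `F`. [folklore] -/
private theorem quad_mem_iff_of_inter_eq {ω ω' F : Set V} (h : ω ∩ F = ω' ∩ F) {i : V}
    (hi : i ∈ F) : i ∈ ω ↔ i ∈ ω' :=
  ⟨fun hω => ((Set.ext_iff.1 h i).1 ⟨hω, hi⟩).1, fun hω' => ((Set.ext_iff.1 h i).2 ⟨hω', hi⟩).1⟩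

/-- The local modification "open `B, D`, close `A, C`" is a measurable self-map of the site
configurations (each coordinate of the image is a Boolean combination of a coordinate and
constants). [folklore] -/
theorem measurable_quadModify (A B C D : V) :
    Measurable fun ω : SiteConfig V => insert B (insert D ω) \ {A, C} := by
  refine measurable_set_iff.2 fun v => ?_
  simp only [Set.mem_sdiff, Set.mem_insert_iff, Set.mem_singleton_iff]
  exact (measurable_const.or (measurable_const.or (measurable_set_mem v))).and measurable_const

/-- On the cylinder `{B, D open, A, C closed}` the local modification is the identity. [folklore] -/
theorem quadModify_eq_self {A B C D : V} {ω : SiteConfig V} (hB : B ∈ ω) (hD : D ∈ ω) (hA : A ∉ ω)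
    (hC : C ∉ ω) : insert B (insert D ω) \ {A, C} = ω := by
  ext v
  simp only [Set.mem_sdiff, Set.mem_insert_iff, Set.mem_singleton_iff, not_or]
  constructor
  · rintro ⟨rfl | rfl | hv, -, -⟩ <;> assumption
  · intro hv
    refine ⟨Or.inr (Or.inr hv), ?_, ?_⟩
    · rintro rfl
      exact hA hv
    · rintro rfl
      exact hC hv

/-- An event read after the local modification is determined by the sites outside
`{A, B, C, D}`: the modification overrides the states of these four sites. [folklore] -/
theorem determinedBy_preimage_quadModify [DecidableEq V] (A B C D : V) (E : Set (SiteConfig V)) :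
    DeterminedBy ((fun ω : SiteConfig V => insert B (insert D ω) \ {A, C}) ⁻¹' E)
      (↑({A, B, C, D} : Finset V) : Set V)ᶜ := by
  rw [determinedBy_iff]
  intro ω ω' h
  have key : insert B (insert D ω) \ {A, C} = insert B (insert D ω') \ {A, C} := by
    ext v
    simp only [Set.mem_sdiff, Set.mem_insert_iff, Set.mem_singleton_iff]
    by_cases hvF : v = A ∨ v = B ∨ v = C ∨ v = D
    · rcases hvF with rfl | rfl | rfl | rfl <;> simp
    · push Not at hvF
      obtain ⟨hvA, hvB, hvC, hvD⟩ := hvF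
      have hvF' : v ∈ (↑({A, B, C, D} : Finset V) : Set V)ᶜ := by
        simp [hvA, hvB, hvC, hvD]
      rw [quad_mem_iff_of_inter_eq h hvF']
  simp only [Set.mem_preimage, key]

/-! ### The four-arm cylinder `{B, D open, A, C closed}` -/

/-- The cylinder `{B, D open, A, C closed}` is determined by the four sites `A, B, C, D`.
[folklore] -/
theorem determinedBy_quadCylinder [DecidableEq V] (A B C D : V) :
    DeterminedBy {ω : SiteConfig V | B ∈ ω ∧ D ∈ ω ∧ A ∉ ω ∧ C ∉ ω}
      (↑({A, B, C, D} : Finset V) : Set V) := by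
  rw [determinedBy_iff]
  intro ω ω' h
  simp only [Set.mem_setOf_eq]
  rw [quad_mem_iff_of_inter_eq h (i := A) (by simp), quad_mem_iff_of_inter_eq h (i := B) (by simp),
    quad_mem_iff_of_inter_eq h (i := C) (by simp), quad_mem_iff_of_inter_eq h (i := D) (by simp)]

/-- The event "all sites of the finite set `F` are open" is determined by `F`. [folklore] -/
theorem quadCyl_determinedBy_subset (F : Finset V) :
    DeterminedBy {ω : SiteConfig V | (↑F : Set V) ⊆ ω} (↑F : Set V) := by
  rw [determinedBy_iff]
  intro ω ω' h
  exact forall₂_congr fun i hi => quad_mem_iff_of_inter_eq h hi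

/-- The event "all sites of the finite set `F` are closed" is determined by `F`. [folklore] -/
theorem quadCyl_determinedBy_forall_notMem (F : Finset V) :
    DeterminedBy {ω : SiteConfig V | ∀ i ∈ F, i ∉ ω} (↑F : Set V) := by
  rw [determinedBy_iff]
  intro ω ω' h
  exact forall₂_congr fun i hi => not_congr (quad_mem_iff_of_inter_eq h (Finset.mem_coe.2 hi))

/-- **`P_p[B, D open, A, C closed] = p² (1 − p)²`** for four distinct sites (product measure:
the open pair `{B, D}` and the closed pair `{A, C}` are independent, of probabilities `p²` and
`(1 − p)²`). [folklore] -/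
theorem sitePercolation_real_quadCylinder [DecidableEq V] (p : unitInterval) {A B C D : V}
    (hAB : A ≠ B) (hAD : A ≠ D) (hCB : C ≠ B) (hCD : C ≠ D) (hAC : A ≠ C) (hBD : B ≠ D) :
    (sitePercolation V p).real {ω : SiteConfig V | B ∈ ω ∧ D ∈ ω ∧ A ∉ ω ∧ C ∉ ω} =
      (p : ℝ) ^ 2 * (1 - p) ^ 2 := by
  have hset : {ω : SiteConfig V | B ∈ ω ∧ D ∈ ω ∧ A ∉ ω ∧ C ∉ ω} =
      {ω | (↑({B, D} : Finset V) : Set V) ⊆ ω} ∩ {ω | ∀ i ∈ ({A, C} : Finset V), i ∉ ω} := by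
    ext ω
    simp [Set.insert_subset_iff, and_assoc]
  have hdisj : Disjoint ({B, D} : Finset V) {A, C} := by
    rw [Finset.disjoint_insert_left, Finset.disjoint_singleton_left]
    simp only [Finset.mem_insert, Finset.mem_singleton, not_or]
    exact ⟨⟨hAB.symm, hCB.symm⟩, hAD.symm, hCD.symm⟩
  have hμ : sitePercolation V p = prodBernoulli fun _ : V => p := by rw [prodBernoulli_const]; rfl
  rw [hset, sitePercolation_real_inter_of_disjoint p (quadCyl_determinedBy_subset {B, D})
    (quadCyl_determinedBy_forall_notMem {A, C}) hdisj, sitePercolation_real_subset,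
    Finset.card_pair hBD, hμ]
  simp only [prodBernoulli_real_forall_notMem, Finset.prod_const, Finset.card_pair hAC]

/-! ### Factorisation of sub-events of the cylinder -/

/-- **Four-arm factorisation.** For four distinct sites `A, B, C, D` and a measurable event `E`
contained in the cylinder `{B, D open, A, C closed}`:
`P_p[E] = p² (1 − p)² · P_p[Φ ω ∈ E]`, where `Φ ω = (ω ∪ {B, D}) ∖ {A, C}` is the local
modification. Indeed `E = Cyl ∩ Φ⁻¹(E)` (`Φ = id` on the cylinder), `Cyl` is determined by the four
sites and `Φ⁻¹(E)` by the other sites, and disjointly supported events are independent under the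
product measure (Grimmett 1999, §2.2). [folklore] -/
theorem sitePercolation_real_eq_of_subset_quadCylinder [DecidableEq V] (p : unitInterval)
    {A B C D : V} (hAB : A ≠ B) (hAD : A ≠ D) (hCB : C ≠ B) (hCD : C ≠ D) (hAC : A ≠ C)
    (hBD : B ≠ D) {E : Set (SiteConfig V)} (hE : E ⊆ {ω | B ∈ ω ∧ D ∈ ω ∧ A ∉ ω ∧ C ∉ ω})
    (hEm : MeasurableSet E) :
    (sitePercolation V p).real E = (p : ℝ) ^ 2 * (1 - p) ^ 2 *
      (sitePercolation V p).real {ω : SiteConfig V | (insert B (insert D ω) \ {A, C}) ∈ E} := by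
  have hEq : E = {ω | B ∈ ω ∧ D ∈ ω ∧ A ∉ ω ∧ C ∉ ω} ∩
      (fun ω : SiteConfig V => insert B (insert D ω) \ {A, C}) ⁻¹' E := by
    ext ω
    simp only [Set.mem_inter_iff, Set.mem_preimage, Set.mem_setOf_eq]
    constructor
    · intro hω
      obtain ⟨hB, hD, hA, hC⟩ := hE hω
      rw [quadModify_eq_self hB hD hA hC]
      exact ⟨⟨hB, hD, hA, hC⟩, hω⟩
    · rintro ⟨⟨hB, hD, hA, hC⟩, hω⟩
      rwa [quadModify_eq_self hB hD hA hC] at hω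
  have hCm : MeasurableSet {ω : SiteConfig V | B ∈ ω ∧ D ∈ ω ∧ A ∉ ω ∧ C ∉ ω} :=
    (determinedBy_quadCylinder A B C D).measurableSet_of_finset
  have hΦm : MeasurableSet ((fun ω : SiteConfig V => insert B (insert D ω) \ {A, C}) ⁻¹' E) :=
    measurable_quadModify A B C D hEm
  have hμ : sitePercolation V p = prodBernoulli fun _ : V => p := by rw [prodBernoulli_const]; rfl
  calc (sitePercolation V p).real E
      = (sitePercolation V p).real ({ω | B ∈ ω ∧ D ∈ ω ∧ A ∉ ω ∧ C ∉ ω} ∩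
          (fun ω : SiteConfig V => insert B (insert D ω) \ {A, C}) ⁻¹' E) := congrArg _ hEq
    _ = (sitePercolation V p).real {ω | B ∈ ω ∧ D ∈ ω ∧ A ∉ ω ∧ C ∉ ω} *
          (sitePercolation V p).real
            ((fun ω : SiteConfig V => insert B (insert D ω) \ {A, C}) ⁻¹' E) := by
        rw [hμ]
        exact prodBernoulli_real_inter_of_determinedBy (fun _ : V => p) {A, B, C, D}
          (determinedBy_quadCylinder A B C D) (determinedBy_preimage_quadModify A B C D E) hCm hΦm
    _ = (p : ℝ) ^ 2 * (1 - p) ^ 2 * (sitePercolation V p).real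
          {ω : SiteConfig V | (insert B (insert D ω) \ {A, C}) ∈ E} := by
        rw [sitePercolation_real_quadCylinder p hAB hAD hCB hCD hAC hBD]
        rfl

/-! ### The stub: factorisation of the flip response of a crossing event -/

/-- **Stub U1 (`crossing_flipGraph_real_sdiff_eq`): four-arm factorisation of the flip
response.** For a quadrilateral `ABCD` of `G` (sides `AB`, `AD`, `CB`, `CD`) with `A ≠ C`, `B ≠ D`
and `A, C` in the domain `S`, the probability that the diagonal flip `AC ↝ BD` CREATES a crossing
`{∃ u ∈ X, ∃ v ∈ Y, u ⟷ v in S}` factors as `p² (1 − p)²` (the cylinder `{B, D open, A, C closed}`,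
forced by `crossing_flipGraph_sdiff_subset`) times the probability of the four-arm event
`{Φ ω ∈ U(flip G) ∖ U(G)}`, `Φ ω = (ω ∪ {B, D}) ∖ {A, C}`, which does not depend on the states
of `A, B, C, D`. (Grimmett 1999, §2.2, §2.4; Beffara 2008, §5.2.) [folklore] -/
theorem crossing_flipGraph_real_sdiff_eq {V : Type*} [DecidableEq V] (p : unitInterval)
    {G : SimpleGraph V} {A B C D : V} {S : Set V} (X Y : Set V)
    (hAS : A ∈ S) (hCS : C ∈ S) (hAB : G.Adj A B) (hAD : G.Adj A D) (hCB : G.Adj C B)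
    (hCD : G.Adj C D) (hAC : A ≠ C) (hBD : B ≠ D)
    (hm : MeasurableSet
      ({ω : SiteConfig V | ∃ u ∈ X, ∃ v ∈ Y, ω ∈ siteConnIn (flipGraph G A B C D) S u v} \
        {ω | ∃ u ∈ X, ∃ v ∈ Y, ω ∈ siteConnIn G S u v})) :
    (sitePercolation V p).real
        ({ω : SiteConfig V | ∃ u ∈ X, ∃ v ∈ Y, ω ∈ siteConnIn (flipGraph G A B C D) S u v} \
          {ω | ∃ u ∈ X, ∃ v ∈ Y, ω ∈ siteConnIn G S u v})
      = (p : ℝ) ^ 2 * (1 - p) ^ 2 *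
        (sitePercolation V p).real
          {ω : SiteConfig V | (insert B (insert D ω) \ {A, C}) ∈
            ({ω' : SiteConfig V | ∃ u ∈ X, ∃ v ∈ Y, ω' ∈ siteConnIn (flipGraph G A B C D) S u v} \
              {ω' | ∃ u ∈ X, ∃ v ∈ Y, ω' ∈ siteConnIn G S u v})} :=
  sitePercolation_real_eq_of_subset_quadCylinder p hAB.ne hAD.ne hCB.ne hCD.ne hAC hBD
    (crossing_flipGraph_sdiff_subset X Y hAS hCS hAB hAD hCB hCD) hm

end Summit.CriticalPhenomena.CardyFormulaZ2.Theorems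

end
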